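import Mathlib
import Summits.ValiantsHypothesis.ValiantsHypothesis.Theorems.TriangularDimersDivisionEasy.Negative.LowerBound

/-!
# Crux `DivisionGap.ZeroOneTransfer` (stmt-ValiantsHypothesis-5066), line `charged-uncharged` —
stub `stub_typedGadgets` (D5, TYPED GADGET SUPPLY)

For vertex sets `Z`, `W` of the rhombus `R_n` call the edge `{u, v}` ALLOWED when
`(u ∈ Z ↔ v ∈ W) ∧ (v ∈ Z ↔ u ∈ W)` (the only edges a dimer cover `f` with `∀ x, x ∈ Z ↔ f x ∈ W` can
use) and FORBIDDEN otherwise.  For balanced `Z` (`n² < 3|Z| ≤ 2n²`, `n ≥ 64`) there are `≥ (n-60)/24`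
validly placed, pairwise far gadgets each carrying a forbidden designated edge: the centre edge
`18–25` (tag `true`) or the diagonal `19–25` (tag `false`).

Proof.  `ALLOWED(u, v)` says that the pattern `(v ∈ Z, v ∈ W)` is the swap of the pattern of `u`, so an
allowed edge never leaves `P₁ = Z ∩ W`, `P₂ = (Z ∪ W)ᶜ` or `E = P₁ ∪ P₂ = {x | x ∈ Z ↔ x ∈ W}`; if one
of these is balanced, Valiant's mixed gadgets for it (`exists_gadgets`) have forbidden centre edges
(`TypedGadgets.gadgets_of_closed`).  Otherwise `3|E| ≤ n²` (`|P₁| ≤ |Z|`, `|P₂| ≤ n² - |Z|`), and for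
every centre `c` of the inner `(n-7) × (n-7)` box with `c ∉ E` one of the three edges of the unit
triangle `{c, c+(1,0), c+(0,1)}` is forbidden (three pairwise allowed edges force `c ∈ E`): the direct
placement at `c` realises `c–(c+(1,0))` as `18–25` and `(c+(0,1))–(c+(1,0))` as `19–25`, the transposed
one realises `c–(c+(0,1))` as `18–25` (`TypedGadgets.triangle_gadget`).  At least `(n-7)² - n²/3`
centres qualify; a residue class of them modulo `8` in both coordinates (`≥ 1/64` of them) is pairwise
far (`TypedGadgets.gadgets_of_spread`).
[folklore]
-/

open MvPolynomial
open Literature.Computability.AlgebraicComplexity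
open Summit.ValiantsHypothesis.ValiantsHypothesis.Theorems.TriangularDimersDivisionEasy.Negative
open scoped NNReal BigOperators
set_option linter.dupNamespace false
noncomputable section
open Classical

namespace Summit.ValiantsHypothesis.ValiantsHypothesis.Theorems.DivisionGapZeroOneTransfer

namespace TypedGadgets

variable {n : ℕ}

/-! ## Case (i): a balanced set which no allowed edge leaves -/

/-- Valiant's mixed gadgets for a balanced set `A` which no allowed edge leaves have forbidden centre
edges (tag `true`). [folklore] -/
theorem gadgets_of_closed (hn : 0 < n) (Z W A : Finset (Vtx n)) (h8 : 8 ≤ n)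
    (hA : ∀ u v : Vtx n, (u ∈ Z ↔ v ∈ W) ∧ (v ∈ Z ↔ u ∈ W) → (u ∈ A ↔ v ∈ A))
    (hA1 : n * n < 3 * A.card) (hA2 : 3 * A.card ≤ 2 * (n * n)) :
    ∃ G : List (Gad × Bool), n ≤ 24 * G.length + 60 ∧
      (∀ g ∈ G, Valid n g.1.1 g.1.2) ∧ (G.map Prod.fst).Pairwise Far ∧
      ∀ g ∈ G,
        (g.2 = true → ¬ ((uOf hn g.1 ∈ Z ↔ vOf hn g.1 ∈ W) ∧ (vOf hn g.1 ∈ Z ↔ uOf hn g.1 ∈ W))) ∧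
        (g.2 = false → ¬ ((vtx hn g.1.1 g.1.2 19 ∈ Z ↔ vtx hn g.1.1 g.1.2 25 ∈ W) ∧
                         (vtx hn g.1.1 g.1.2 25 ∈ Z ↔ vtx hn g.1.1 g.1.2 19 ∈ W))) := by
  obtain ⟨G, hlen, hV, hfar, hmix⟩ := exists_gadgets hn A h8 hA1 hA2
  refine ⟨G.map fun g => (g, true), ?_, ?_, ?_, ?_⟩
  · rw [List.length_map]; exact hlen
  · intro g hg
    rw [List.mem_map] at hg
    obtain ⟨g₀, hg₀, rfl⟩ := hg
    exact hV g₀ hg₀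
  · rw [List.map_map]
    have : (Prod.fst ∘ fun g : Gad => (g, true)) = id := rfl
    rw [this, List.map_id]
    exact hfar
  · intro g hg
    rw [List.mem_map] at hg
    obtain ⟨g₀, hg₀, rfl⟩ := hg
    refine ⟨fun _ hall => ?_, fun h => Bool.noConfusion h⟩
    have hiff := hA _ _ hall
    rcases hmix g₀ hg₀ with ⟨hu, hv⟩ | ⟨hu, hv⟩
    · exact hv (hiff.1 hu)
    · exact hu (hiff.2 hv)

/-! ## Case (ii): the unit triangle at a centre outside `E` -/

/-- Ball index `19` is `(0,1)`. [folklore] -/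
theorem coord_19 : coord 19 = (0, 1) := by decide

/-- For a direct gadget centred at `(i, j)` the ball vertex `19` is `(i, j+1)`. [folklore] -/
theorem vtx_19_eq_false (hn : 0 < n) {i j : ℕ} (hi : i < n) (hj : j + 1 < n)
    (hV : Valid n false ((i : ℤ), (j : ℤ))) :
    vtx hn false ((i : ℤ), (j : ℤ)) 19 = ((⟨i, hi⟩, ⟨j + 1, hj⟩) : Vtx n) := by
  apply zof_injective
  rw [zof_vtx hn false _ hV (by norm_num), coord_19]
  simp [place, zof]

/-- **The triangle lemma.**  If the centre `c = (i, j)` of the inner box is not in `E`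
(`¬ (c ∈ Z ↔ c ∈ W)`), one of the edges `c–(c+(1,0))` (direct `18–25`, tag `true`),
`(c+(0,1))–(c+(1,0))` (direct `19–25`, tag `false`), `c–(c+(0,1))` (transposed `18–25`, tag `true`) is
forbidden — three pairwise allowed edges would give `c ∈ Z ↔ c+(1,0) ∈ W ↔ c+(0,1) ∈ Z ↔ c ∈ W` —
and the corresponding placement at `c` is valid. [folklore] -/
theorem triangle_gadget (hn : 0 < n) (Z W : Finset (Vtx n)) {i j : ℕ} {c : ℤ × ℤ}
    (hc : c = ((i : ℤ), (j : ℤ))) (hi3 : 3 ≤ i) (hi5 : i + 5 ≤ n) (hj3 : 3 ≤ j) (hj5 : j + 5 ≤ n)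
    (hne : ¬ (memN Z i j ↔ memN W i j)) :
    ∃ gb : Gad × Bool, gb.1.2 = c ∧ Valid n gb.1.1 gb.1.2 ∧
      (gb.2 = true → ¬ ((uOf hn gb.1 ∈ Z ↔ vOf hn gb.1 ∈ W) ∧ (vOf hn gb.1 ∈ Z ↔ uOf hn gb.1 ∈ W))) ∧
      (gb.2 = false → ¬ ((vtx hn gb.1.1 gb.1.2 19 ∈ Z ↔ vtx hn gb.1.1 gb.1.2 25 ∈ W) ∧
                        (vtx hn gb.1.1 gb.1.2 25 ∈ Z ↔ vtx hn gb.1.1 gb.1.2 19 ∈ W))) := by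
  have hi : i < n := by omega
  have hi1 : i + 1 < n := by omega
  have hj : j < n := by omega
  have hj1 : j + 1 < n := by omega
  have hVf : Valid n false c := by
    subst hc
    exact valid_of_bounds_false (show (3 : ℤ) ≤ i by omega) (show (i : ℤ) + 4 < n by omega)
      (show (3 : ℤ) ≤ j by omega) (show (j : ℤ) + 3 < n by omega)
  have hVt : Valid n true c := by
    subst hc
    exact valid_of_bounds_true (show (3 : ℤ) ≤ i by omega) (show (i : ℤ) + 3 < n by omega)
      (show (3 : ℤ) ≤ j by omega) (show (j : ℤ) + 4 < n by omega)
  -- the three vertices `c`, `c + (1,0)`, `c + (0,1)` of the unit triangle, in both placements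
  have e18f : vtx hn false c 18 = ((⟨i, hi⟩, ⟨j, hj⟩) : Vtx n) := by
    subst hc; exact vtx_18_eq hn false hi hj hVf
  have e25f : vtx hn false c 25 = ((⟨i + 1, hi1⟩, ⟨j, hj⟩) : Vtx n) := by
    subst hc; exact vtx_25_eq_false hn hi1 hj hVf
  have e19f : vtx hn false c 19 = ((⟨i, hi⟩, ⟨j + 1, hj1⟩) : Vtx n) := by
    subst hc; exact vtx_19_eq_false hn hi hj1 hVf
  have e18t : vtx hn true c 18 = ((⟨i, hi⟩, ⟨j, hj⟩) : Vtx n) := by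
    subst hc; exact vtx_18_eq hn true hi hj hVt
  have e25t : vtx hn true c 25 = ((⟨i, hi⟩, ⟨j + 1, hj1⟩) : Vtx n) := by
    subst hc; exact vtx_25_eq_true hn hi hj1 hVt
  rw [memN_iff hi hj, memN_iff hi hj] at hne
  by_cases h01 : (vtx hn false c 18 ∈ Z ↔ vtx hn false c 25 ∈ W) ∧
      (vtx hn false c 25 ∈ Z ↔ vtx hn false c 18 ∈ W)
  · by_cases h21 : (vtx hn false c 19 ∈ Z ↔ vtx hn false c 25 ∈ W) ∧
        (vtx hn false c 25 ∈ Z ↔ vtx hn false c 19 ∈ W)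
    · -- both direct edges allowed: the transposed centre edge `c–(c+(0,1))` is forbidden
      refine ⟨((true, c), true), rfl, hVt, fun _ h02 => ?_, fun h => Bool.noConfusion h⟩
      change (vtx hn true c 18 ∈ Z ↔ vtx hn true c 25 ∈ W) ∧
        (vtx hn true c 25 ∈ Z ↔ vtx hn true c 18 ∈ W) at h02
      rw [e18t, e25t] at h02
      rw [e18f, e25f] at h01
      rw [e19f, e25f] at h21
      exact hne (h01.1.trans (h21.1.symm.trans h02.2))
    · exact ⟨((false, c), false), rfl, hVf, fun h => Bool.noConfusion h, fun _ => h21⟩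
  · exact ⟨((false, c), true), rfl, hVf, fun _ => h01, fun h => Bool.noConfusion h⟩

/-! ## Case (ii): counting and far-apart selection -/

/-- If `3|E| ≤ n²` for `E = {x | x ∈ Z ↔ x ∈ W}` (`n ≥ 64`), the centres outside `E` in one residue
class modulo `8` (both coordinates) of the inner box supply the gadgets: the inner box has `(n-7)²`
centres, those in `E` are at most `n²/3`, the best of the `64` classes holds `≥ 1/64` of the rest, and
`((n-7)² - n²/3)/64 ≥ (n-60)/24`. [folklore] -/
theorem gadgets_of_spread (hn : 0 < n) (Z W : Finset (Vtx n)) (h64 : 64 ≤ n)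
    (hE : 3 * (Finset.univ.filter fun x : Vtx n => (x ∈ Z ↔ x ∈ W)).card ≤ n * n) :
    ∃ G : List (Gad × Bool), n ≤ 24 * G.length + 60 ∧
      (∀ g ∈ G, Valid n g.1.1 g.1.2) ∧ (G.map Prod.fst).Pairwise Far ∧
      ∀ g ∈ G,
        (g.2 = true → ¬ ((uOf hn g.1 ∈ Z ↔ vOf hn g.1 ∈ W) ∧ (vOf hn g.1 ∈ Z ↔ uOf hn g.1 ∈ W))) ∧
        (g.2 = false → ¬ ((vtx hn g.1.1 g.1.2 19 ∈ Z ↔ vtx hn g.1.1 g.1.2 25 ∈ W) ∧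
                         (vtx hn g.1.1 g.1.2 25 ∈ Z ↔ vtx hn g.1.1 g.1.2 19 ∈ W))) := by
  obtain ⟨m, rfl⟩ : ∃ m, n = m + 7 := ⟨n - 7, by omega⟩
  set E := Finset.univ.filter fun x : Vtx (m + 7) => (x ∈ Z ↔ x ∈ W) with hEdef
  set C : Finset (ℕ × ℕ) := Finset.Ico 3 (m + 3) ×ˢ Finset.Ico 3 (m + 3) with hCdef
  set D : Finset (ℕ × ℕ) := C.filter fun p => ¬ (memN Z p.1 p.2 ↔ memN W p.1 p.2) with hDdef
  set B : Finset (ℕ × ℕ) := C.filter fun p => (memN Z p.1 p.2 ↔ memN W p.1 p.2) with hBdef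
  have hC : C.card = m * m := by
    rw [hCdef, Finset.card_product, Nat.card_Ico, Nat.add_sub_cancel]
  have hBD : B.card + D.card = C.card := Finset.card_filter_add_card_filter_not _
  -- the centres in `E` inject into `E`
  have hB : B.card ≤ E.card := by
    calc B.card ≤ (E.image fun x : Vtx (m + 7) => ((x.1 : ℕ), (x.2 : ℕ))).card := by
          apply Finset.card_le_card
          intro p hp
          rw [hBdef, Finset.mem_filter, hCdef, Finset.mem_product, Finset.mem_Ico, Finset.mem_Ico] at hp
          obtain ⟨⟨⟨-, h2⟩, -, h4⟩, hiff⟩ := hp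
          have hp1 : p.1 < m + 7 := by omega
          have hp2 : p.2 < m + 7 := by omega
          rw [memN_iff hp1 hp2, memN_iff hp1 hp2] at hiff
          rw [Finset.mem_image]
          exact ⟨(⟨p.1, hp1⟩, ⟨p.2, hp2⟩), Finset.mem_filter.2 ⟨Finset.mem_univ _, hiff⟩, rfl⟩
      _ ≤ E.card := Finset.card_image_le
  -- one residue class modulo 8 in both coordinates
  obtain ⟨r₁, -, hr₁⟩ := exists_mod_class D Prod.fst
  obtain ⟨r₂, -, hr₂⟩ := exists_mod_class (D.filter fun p => p.1 % 8 = r₁) Prod.snd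
  set R : Finset (ℕ × ℕ) := (D.filter fun p => p.1 % 8 = r₁).filter fun p => p.2 % 8 = r₂ with hRdef
  have hR₁ : D.card ≤ 8 * (D.filter fun p => p.1 % 8 = r₁).card := hr₁
  have hR₂ : (D.filter fun p => p.1 % 8 = r₁).card ≤ 8 * R.card := hr₂
  have hRD : ∀ p ∈ R, p ∈ D ∧ p.1 % 8 = r₁ ∧ p.2 % 8 = r₂ := by
    intro p hp
    rw [hRdef, Finset.mem_filter, Finset.mem_filter] at hp
    exact ⟨hp.1.1, hp.1.2, hp.2⟩
  -- a valid tagged gadget with a forbidden designated edge at every centre of `D`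
  have key : ∀ p ∈ D, ∃ gb : Gad × Bool, gb.1.2 = ((p.1 : ℤ), (p.2 : ℤ)) ∧ Valid (m + 7) gb.1.1 gb.1.2 ∧
      (gb.2 = true → ¬ ((uOf hn gb.1 ∈ Z ↔ vOf hn gb.1 ∈ W) ∧ (vOf hn gb.1 ∈ Z ↔ uOf hn gb.1 ∈ W))) ∧
      (gb.2 = false → ¬ ((vtx hn gb.1.1 gb.1.2 19 ∈ Z ↔ vtx hn gb.1.1 gb.1.2 25 ∈ W) ∧
                        (vtx hn gb.1.1 gb.1.2 25 ∈ Z ↔ vtx hn gb.1.1 gb.1.2 19 ∈ W))) := by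
    intro p hp
    rw [hDdef, Finset.mem_filter, hCdef, Finset.mem_product, Finset.mem_Ico, Finset.mem_Ico] at hp
    obtain ⟨⟨⟨h1, h2⟩, h3, h4⟩, hne⟩ := hp
    exact triangle_gadget hn Z W (i := p.1) (j := p.2) rfl h1 (by omega) h3 (by omega) hne
  choose! gOf hgOf using key
  refine ⟨R.toList.map gOf, ?_, ?_, ?_, ?_⟩
  · -- counting: `64 |R| ≥ |D| = m² - |B| ≥ m² - |E| ≥ m² - (m+7)²/3`
    rw [List.length_map, Finset.length_toList]
    have hm : 57 * m ≤ m * m := Nat.mul_le_mul_right m (by omega)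
    linarith
  · intro g hg
    rw [List.mem_map] at hg
    obtain ⟨p, hp, rfl⟩ := hg
    rw [Finset.mem_toList] at hp
    exact (hgOf p (hRD p hp).1).2.1
  · rw [List.map_map, List.pairwise_map]
    apply List.Pairwise.imp_of_mem (R := fun a b => a ≠ b)
    · intro a b ha hb hab
      rw [Finset.mem_toList] at ha hb
      obtain ⟨haD, ha1, ha2⟩ := hRD a ha
      obtain ⟨hbD, hb1, hb2⟩ := hRD b hb
      show Far (gOf a).1 (gOf b).1
      unfold Far
      rw [(hgOf a haD).1, (hgOf b hbD).1]
      by_cases h1 : a.1 = b.1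
      · right
        exact eight_le_abs_sub (fun h2 => hab (Prod.ext h1 h2)) (by rw [ha2, hb2])
      · left
        exact eight_le_abs_sub h1 (by rw [ha1, hb1])
    · exact (Finset.nodup_toList R).pairwise_of_forall_ne fun a _ b _ hab => hab
  · intro g hg
    rw [List.mem_map] at hg
    obtain ⟨p, hp, rfl⟩ := hg
    rw [Finset.mem_toList] at hp
    exact (hgOf p (hRD p hp).1).2.2

end TypedGadgets

open TypedGadgets in
/-- **Stub D5 — TYPED GADGET SUPPLY.**  For a balanced `Z` (`n² < 3|Z| ≤ 2n²`, `n ≥ 64`) and any `W`,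
call the edge `{u, v}` FORBIDDEN when `¬((u ∈ Z ↔ v ∈ W) ∧ (v ∈ Z ↔ u ∈ W))` (no dimer cover `f` with
`∀ x, x ∈ Z ↔ f x ∈ W` can match `u` with `v`).  There are `≥ (n-60)/24` validly placed, pairwise far
gadgets each carrying a forbidden designated edge: its centre edge `18–25` (tag `true`) or its
diagonal `19–25` (tag `false`).  Cases: one of `P₁ = Z ∩ W`, `P₂ = (Z ∪ W)ᶜ`, `E = P₁ ∪ P₂` (sets no
allowed edge leaves) is balanced — Valiant's mixed gadgets for it (`exists_gadgets`; mixed ⇒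
forbidden); otherwise `3 |E| ≤ n²` and every unit triangle `{c, c+(1,0), c+(0,1)}` with `c ∉ E` has a
forbidden edge (direct placement at `c`: `18–25` or `19–25`; transposed: `18–25 = c–(c+(0,1))`),
`≥ (n-7)² - n²/3` candidates, a residue class of centres mod `8` is pairwise far. [folklore] -/
theorem stub_typedGadgets :
    ∀ (n : ℕ) (hn : 0 < n) (Z W : Finset (Fin n × Fin n)), 64 ≤ n →
      n * n < 3 * Z.card → 3 * Z.card ≤ 2 * (n * n) →
      ∃ G : List (Gad × Bool), n ≤ 24 * G.length + 60 ∧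
        (∀ g ∈ G, Valid n g.1.1 g.1.2) ∧ (G.map Prod.fst).Pairwise Far ∧
        ∀ g ∈ G,
          (g.2 = true → ¬ ((uOf hn g.1 ∈ Z ↔ vOf hn g.1 ∈ W) ∧ (vOf hn g.1 ∈ Z ↔ uOf hn g.1 ∈ W))) ∧
          (g.2 = false → ¬ ((vtx hn g.1.1 g.1.2 19 ∈ Z ↔ vtx hn g.1.1 g.1.2 25 ∈ W) ∧
                           (vtx hn g.1.1 g.1.2 25 ∈ Z ↔ vtx hn g.1.1 g.1.2 19 ∈ W))) := by
  intro n hn Z W h64 hZ1 hZ2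
  -- the swap classes `P₁ = Z ∩ W`, `P₂ = (Z ∪ W)ᶜ` and their union `E`
  set P₁ := Finset.univ.filter fun x : Vtx n => x ∈ Z ∧ x ∈ W with hP₁
  set P₂ := Finset.univ.filter fun x : Vtx n => x ∉ Z ∧ x ∉ W with hP₂
  set E := Finset.univ.filter fun x : Vtx n => (x ∈ Z ↔ x ∈ W) with hE
  have hEle : E.card ≤ P₁.card + P₂.card := by
    calc E.card ≤ (P₁ ∪ P₂).card := by
          apply Finset.card_le_card
          intro x hx
          rw [hE, Finset.mem_filter] at hx
          rw [Finset.mem_union, hP₁, hP₂, Finset.mem_filter, Finset.mem_filter]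
          by_cases hxZ : x ∈ Z
          · exact Or.inl ⟨Finset.mem_univ _, hxZ, hx.2.1 hxZ⟩
          · exact Or.inr ⟨Finset.mem_univ _, hxZ, fun hxW => hxZ (hx.2.2 hxW)⟩
      _ ≤ P₁.card + P₂.card := Finset.card_union_le _ _
  have hP₁Z : P₁.card ≤ Z.card :=
    Finset.card_le_card fun x hx => (Finset.mem_filter.1 hx).2.1
  have hP₂Z : P₂.card + Z.card ≤ n * n := by
    have hdisj : Disjoint P₂ Z :=
      Finset.disjoint_left.2 fun x hx hxZ => (Finset.mem_filter.1 hx).2.1 hxZ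
    rw [← Finset.card_union_of_disjoint hdisj]
    exact (Finset.card_le_univ _).trans_eq (by simp)
  have h8 : 8 ≤ n := by omega
  by_cases h1 : n * n < 3 * P₁.card
  · have hcl : ∀ u v : Vtx n, (u ∈ Z ↔ v ∈ W) ∧ (v ∈ Z ↔ u ∈ W) → (u ∈ P₁ ↔ v ∈ P₁) := by
      intro u v huv
      simp only [hP₁, Finset.mem_filter, Finset.mem_univ, true_and]
      tauto
    exact gadgets_of_closed hn Z W P₁ h8 hcl h1 (by linarith)
  by_cases h2 : n * n < 3 * P₂.card
  · have hcl : ∀ u v : Vtx n, (u ∈ Z ↔ v ∈ W) ∧ (v ∈ Z ↔ u ∈ W) → (u ∈ P₂ ↔ v ∈ P₂) := by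
      intro u v huv
      simp only [hP₂, Finset.mem_filter, Finset.mem_univ, true_and]
      tauto
    exact gadgets_of_closed hn Z W P₂ h8 hcl h2 (by linarith)
  by_cases h3 : n * n < 3 * E.card
  · have hcl : ∀ u v : Vtx n, (u ∈ Z ↔ v ∈ W) ∧ (v ∈ Z ↔ u ∈ W) → (u ∈ E ↔ v ∈ E) := by
      intro u v huv
      simp only [hE, Finset.mem_filter, Finset.mem_univ, true_and]
      tauto
    exact gadgets_of_closed hn Z W E h8 hcl h3 (by linarith [not_lt.1 h1, not_lt.1 h2])
  exact gadgets_of_spread hn Z W h64 (not_lt.1 h3)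

end Summit.ValiantsHypothesis.ValiantsHypothesis.Theorems.DivisionGapZeroOneTransfer

end
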